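import Summits.Parity.BatemanHorn.Theorems.SoloInformedThinCounting
import HarnessLib

/-!
# Thin sequences vs. Type-I/II information, II: the bilinear form (II) against a thin support

Part of the `SoloInformedThin*` series (`…Counting`, `…TypeII`, `…TypeIIVoid`, `…TypeI`,
`…Polynomial`), which turns Ford–Maynard's heuristic remark (arXiv:2407.14368, §2.4: for the
normalised indicator of a set `𝒥 ⊆ (x/2, x]` with `x^{1-c}` elements "one can only hope for (I)
to hold for `γ < 1 − c` and (II) for `θ > c`") into theorems about EVERY real sequence with thin
support, in the tree's exact formalisation `Literature.Barriers.Parity.FordMaynard.TypeI` /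
`TypeII` (comparison sequence `b = 1`, `w = a − 1`).  The tree's barrier entry
`Literature.Barriers.Parity.FordMaynardLowLevel` flags the remark as "a HEURISTIC remark of the
paper, not a theorem about any specific thin set"; these files supply the theorem.

This file: explicit inequalities extracted from (II).
* `typeII_zero_pairs_le` — testing (II) for `w = a − 1` with indicator coefficients `ξ = 1_f`,
  `κ = 1_g` (admissible: `|·| ≤ 1 ≤ τ^B`) such that `f m ∧ g n ⇒ a(mn) = 0` shows that the
  number of such pairs in the Type-II summation is `≤ x/(log x)^B`;
* `typeII_sparse_le` — primes `p > M` of a set `S` inside the window `((x/2)^θ, x^{θ+ν}]` on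
  the `m`-side, good cofactors on the `n`-side:
  `∑_{p ∈ S} (x/(2p) − 1) − #S · #A · log x / log M ≤ x/(log x)^B` whenever `A ⊇ supp a ∩ (x/2, x]`;
* `typeII_sparse_le'` — the same with the primes on the `n`-side (reflected window
  `p (x/2)^θ ≤ x/2`, `x ≤ p x^{θ+ν}`), via the double count `sum_card_filter_swap_le`.

References: [cite: FordMaynard2024PrimeSieves, §2.4 (p. 7, first family and footnote)]
[cite: FordMaynard2024PrimeSieves, §1 (II)].
-/

noncomputable section

open Filter Finset Real

namespace Summit.Parity.BatemanHorn.Theorems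

open Literature.Barriers.Parity.FordMaynard (TypeII)

/-! ### The bilinear form of (II) against indicator coefficients -/

/-- **Zero pairs are counted by (II).**  If `f m ∧ g n` forces `a(mn) = 0` on `x/2 < mn ≤ x`, then
testing (II) for `w = a − 1` with `ξ = 1_f`, `κ = 1_g` shows that the number of pairs `(m, n)` of
the Type-II summation with `f m ∧ g n` is at most `x/(log x)^B`.
[cite: FordMaynard2024PrimeSieves, §1 (II)] -/
theorem typeII_zero_pairs_le {a : ℕ → ℝ} {x θ ν B : ℝ} (hB : 0 ≤ B) (f g : ℕ → Prop)
    [DecidablePred f] [DecidablePred g]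
    (hfg : ∀ m n : ℕ, f m → g n → x / 2 < (m * n : ℝ) → (m * n : ℝ) ≤ x → a (m * n) = 0)
    (h : TypeII (fun n : ℕ => a n - 1) x θ ν B) :
    ∑ m ∈ (Icc 1 ⌊x ^ (θ + ν)⌋₊).filter (fun m : ℕ => (x / 2) ^ θ < (m : ℝ)),
        ((((Icc 1 ⌊x⌋₊).filter
            (fun n : ℕ => x / 2 < (m * n : ℝ) ∧ (m * n : ℝ) ≤ x)).filter
          (fun n : ℕ => f m ∧ g n)).card : ℝ)
      ≤ x / Real.log x ^ B := by
  set W : Finset ℕ :=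
    (Icc 1 ⌊x ^ (θ + ν)⌋₊).filter (fun m : ℕ => (x / 2) ^ θ < (m : ℝ)) with hW
  set Nw : ℕ → Finset ℕ := fun m : ℕ =>
    (Icc 1 ⌊x⌋₊).filter (fun n : ℕ => x / 2 < (m * n : ℝ) ∧ (m * n : ℝ) ≤ x) with hNw
  set ξ : ℕ → ℂ := fun m : ℕ => if m ≠ 0 ∧ f m then 1 else 0 with hξ
  set κ : ℕ → ℂ := fun n : ℕ => if n ≠ 0 ∧ g n then 1 else 0 with hκ
  have key : ‖∑ m ∈ W, ∑ n ∈ Nw m, ξ m * κ n * ((a (m * n) - 1 : ℝ) : ℂ)‖ ≤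
      x / Real.log x ^ B :=
    h ξ κ (fun m : ℕ => norm_indicator_le_divisors_rpow hB f m)
      (fun n : ℕ => norm_indicator_le_divisors_rpow hB g n)
  have hterm : ∀ m ∈ W, ∀ n ∈ Nw m,
      ξ m * κ n * ((a (m * n) - 1 : ℝ) : ℂ) = if f m ∧ g n then -1 else 0 := by
    intro m hm n hn
    have hm' : m ∈ W := hm
    simp only [hW, mem_filter, mem_Icc] at hm'
    have hm0 : m ≠ 0 := by omega
    have hn' : n ∈ Nw m := hn
    simp only [hNw, mem_filter, mem_Icc] at hn'
    have hn0 : n ≠ 0 := by omega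
    by_cases hc : f m ∧ g n
    · have h0 := hfg m n hc.1 hc.2 hn'.2.1 hn'.2.2
      simp [hξ, hκ, hm0, hn0, hc, h0]
    · rw [if_neg hc]
      rcases not_and_or.mp hc with h1 | h1
      · simp [hξ, h1]
      · simp [hκ, h1]
  have hsum : ∑ m ∈ W, ∑ n ∈ Nw m, ξ m * κ n * ((a (m * n) - 1 : ℝ) : ℂ) =
      -(((∑ m ∈ W, ((Nw m).filter (fun n : ℕ => f m ∧ g n)).card : ℕ) : ℂ)) := by
    rw [Nat.cast_sum, ← Finset.sum_neg_distrib]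
    refine Finset.sum_congr rfl fun m hm => ?_
    rw [Finset.card_filter, Nat.cast_sum, ← Finset.sum_neg_distrib]
    refine Finset.sum_congr rfl fun n hn => ?_
    rw [hterm m hm n hn]
    split_ifs <;> simp
  rw [hsum, norm_neg, Complex.norm_natCast, Nat.cast_sum] at key
  exact key

/-! ### Explicit inequalities -/

/-- Double counting for the reflected window: pairs `(m, p)`, `m ∈ W`, `p ∈ S ⊆ [1, x]`,
`x/2 < mp ≤ x`, `G m`, counted by `p` and by `m`. [folklore] -/
theorem sum_card_filter_swap_le {x : ℝ} (W S : Finset ℕ) (hS : S ⊆ Icc 1 ⌊x⌋₊) (G : ℕ → Prop)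
    [DecidablePred G] :
    ∑ p ∈ S, ((W.filter (fun m : ℕ => (x / 2 < (m * p : ℝ) ∧ (m * p : ℝ) ≤ x) ∧ G m)).card : ℝ)
      ≤ ∑ m ∈ W, ((((Icc 1 ⌊x⌋₊).filter
          (fun n : ℕ => x / 2 < (m * n : ℝ) ∧ (m * n : ℝ) ≤ x)).filter
            (fun n : ℕ => G m ∧ n ∈ S)).card : ℝ) := by
  have lhs : ∀ p ∈ S, ((W.filter (fun m : ℕ =>
        (x / 2 < (m * p : ℝ) ∧ (m * p : ℝ) ≤ x) ∧ G m)).card : ℝ)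
      = ∑ m ∈ W, (if (x / 2 < (m * p : ℝ) ∧ (m * p : ℝ) ≤ x) ∧ (G m ∧ p ∈ S)
          then 1 else 0 : ℝ) := by
    intro p hp
    rw [Finset.card_filter]
    push_cast
    refine sum_congr rfl fun m _ => ?_
    simp only [hp, and_true]
  have rhs : ∀ m ∈ W, ((((Icc 1 ⌊x⌋₊).filter
          (fun n : ℕ => x / 2 < (m * n : ℝ) ∧ (m * n : ℝ) ≤ x)).filter
            (fun n : ℕ => G m ∧ n ∈ S)).card : ℝ)
      = ∑ n ∈ Icc 1 ⌊x⌋₊, (if (x / 2 < (m * n : ℝ) ∧ (m * n : ℝ) ≤ x) ∧ (G m ∧ n ∈ S)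
          then 1 else 0 : ℝ) := by
    intro m _
    rw [Finset.filter_filter, Finset.card_filter]
    push_cast
    rfl
  calc ∑ p ∈ S, ((W.filter (fun m : ℕ =>
          (x / 2 < (m * p : ℝ) ∧ (m * p : ℝ) ≤ x) ∧ G m)).card : ℝ)
        = ∑ p ∈ S, ∑ m ∈ W, (if (x / 2 < (m * p : ℝ) ∧ (m * p : ℝ) ≤ x) ∧ (G m ∧ p ∈ S)
            then 1 else 0 : ℝ) := sum_congr rfl lhs
      _ = ∑ m ∈ W, ∑ p ∈ S, (if (x / 2 < (m * p : ℝ) ∧ (m * p : ℝ) ≤ x) ∧ (G m ∧ p ∈ S)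
            then 1 else 0 : ℝ) := Finset.sum_comm
      _ ≤ ∑ m ∈ W, ∑ n ∈ Icc 1 ⌊x⌋₊,
            (if (x / 2 < (m * n : ℝ) ∧ (m * n : ℝ) ≤ x) ∧ (G m ∧ n ∈ S)
              then 1 else 0 : ℝ) :=
          sum_le_sum fun m _ =>
            sum_le_sum_of_subset_of_nonneg hS (fun _ _ _ => by split_ifs <;> norm_num)
      _ = _ := (sum_congr rfl rhs).symm

/-- **(II) against a thin support, primes on the `m`-side.**  Let `S` be a finite set of primes
`p > M` lying in the Type-II window `((x/2)^θ, x^{θ+ν}]`, and let `A` contain the support of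
`a` on `(x/2, x]`.  If `w = a − 1` satisfies (II), then
`∑_{p ∈ S} (x/(2p) − 1) − #S · (#A · log x / log M) ≤ x / (log x)^B`.
[cite: FordMaynard2024PrimeSieves, §2.4] -/
theorem typeII_sparse_le {a : ℕ → ℝ} {x θ ν B : ℝ} (hB : 0 ≤ B) (hx : 1 ≤ x) {M : ℝ}
    (hM : 1 < M) (S A : Finset ℕ)
    (hS : ∀ p ∈ S, p.Prime ∧ M < (p : ℝ) ∧ (x / 2) ^ θ < (p : ℝ) ∧ (p : ℝ) ≤ x ^ (θ + ν))
    (hA : ∀ v : ℕ, x / 2 < (v : ℝ) → (v : ℝ) ≤ x → a v ≠ 0 → v ∈ A)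
    (h : TypeII (fun n : ℕ => a n - 1) x θ ν B) :
    ∑ p ∈ S, (x / (2 * p) - 1) - S.card * (A.card * (Real.log x / Real.log M))
      ≤ x / Real.log x ^ B := by
  set L := Real.log x / Real.log M with hL
  set W : Finset ℕ :=
    (Icc 1 ⌊x ^ (θ + ν)⌋₊).filter (fun m : ℕ => (x / 2) ^ θ < (m : ℝ)) with hW
  set Nw : ℕ → Finset ℕ := fun m : ℕ =>
    (Icc 1 ⌊x⌋₊).filter (fun n : ℕ => x / 2 < (m * n : ℝ) ∧ (m * n : ℝ) ≤ x) with hNw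
  -- (II) tested against `ξ = 1_S`, `κ = 1_{good cofactors}`
  have hT : ∑ m ∈ W, (((Nw m).filter (fun n : ℕ => m ∈ S ∧
      ∀ q ∈ S, x / 2 < (q * n : ℝ) → (q * n : ℝ) ≤ x → a (q * n) = 0)).card : ℝ) ≤
      x / Real.log x ^ B :=
    typeII_zero_pairs_le hB (fun m : ℕ => m ∈ S)
      (fun n : ℕ => ∀ q ∈ S, x / 2 < (q * n : ℝ) → (q * n : ℝ) ≤ x → a (q * n) = 0)
      (fun m n hm hn h1 h2 => hn m hm h1 h2) h
  have hS' : ∀ p ∈ S, p.Prime ∧ M < (p : ℝ) := fun p hp => ⟨(hS p hp).1, (hS p hp).2.1⟩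
  have hSW : S ⊆ W := by
    intro p hp
    obtain ⟨hpr, _, h1, h2⟩ := hS p hp
    rw [hW, Finset.mem_filter, mem_Icc]
    exact ⟨⟨hpr.one_le, Nat.le_floor h2⟩, h1⟩
  -- the bad cofactors
  set E : Finset ℕ := (Icc 1 ⌊x⌋₊).filter (fun r : ℕ => ∃ p : ℕ, p ∈ S ∧
      (x / 2 < (p * r : ℝ) ∧ (p * r : ℝ) ≤ x) ∧ a (p * r) ≠ 0) with hE
  have hEcard : (E.card : ℝ) ≤ A.card * L :=
    card_badCofactors_le hx hM S A E hS' hA (fun r hr => by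
      have hr' := hr
      simp only [hE, Finset.mem_filter] at hr'
      exact hr'.2)
  have hstep : ∀ p ∈ S, x / (2 * p) - 1 - A.card * L ≤
      (((Nw p).filter (fun n : ℕ => p ∈ S ∧
        ∀ q ∈ S, x / 2 < (q * n : ℝ) → (q * n : ℝ) ≤ x → a (q * n) = 0)).card : ℝ) := by
    intro p hp
    have hp0 : 0 < p := (hS p hp).1.pos
    -- the cofactor interval sits inside `Nw p`
    have hsub1 : Ioc ⌊x / (2 * p)⌋₊ ⌊x / p⌋₊ ⊆ Nw p := by
      intro r hr
      obtain ⟨hr1, h1, h2⟩ := mem_Ioc_cofactor (by linarith) hp0 hr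
      simp only [hNw, Finset.mem_filter, mem_Icc]
      refine ⟨⟨hr1, Nat.le_floor ?_⟩, h1, h2⟩
      have hp1 : (1 : ℝ) ≤ p := by exact_mod_cast hp0
      have : (r : ℝ) ≤ p * r := le_mul_of_one_le_left (Nat.cast_nonneg _) hp1
      linarith
    have hN : x / (2 * p) - 1 ≤ ((Nw p).card : ℝ) :=
      (sub_one_le_card_Ioc_cofactor (by linarith) hp0).trans
        (by exact_mod_cast card_le_card hsub1)
    -- good cofactors ⊇ `Nw p \ E`
    have hsub2 : Nw p \ E ⊆ (Nw p).filter (fun n : ℕ => p ∈ S ∧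
        ∀ q ∈ S, x / 2 < (q * n : ℝ) → (q * n : ℝ) ≤ x → a (q * n) = 0) := by
      intro n hn
      rw [Finset.mem_sdiff] at hn
      rw [Finset.mem_filter]
      refine ⟨hn.1, hp, fun q hq h1 h2 => ?_⟩
      by_contra hne
      apply hn.2
      have hnI : n ∈ Icc 1 ⌊x⌋₊ := by
        have := hn.1
        simp only [hNw, Finset.mem_filter] at this
        exact this.1
      simp only [hE, Finset.mem_filter]
      exact ⟨hnI, q, hq, ⟨h1, h2⟩, hne⟩
    have h1 : (Nw p).card ≤ ((Nw p).filter (fun n : ℕ => p ∈ S ∧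
        ∀ q ∈ S, x / 2 < (q * n : ℝ) → (q * n : ℝ) ≤ x → a (q * n) = 0)).card + E.card :=
      (Finset.card_le_card_sdiff_add_card).trans (Nat.add_le_add_right (card_le_card hsub2) _)
    have h1' : ((Nw p).card : ℝ) ≤ ((Nw p).filter (fun n : ℕ => p ∈ S ∧
        ∀ q ∈ S, x / 2 < (q * n : ℝ) → (q * n : ℝ) ≤ x → a (q * n) = 0)).card + E.card := by
      exact_mod_cast h1
    linarith
  have hsum := sum_le_sum hstep
  have hsub : ∑ p ∈ S, (((Nw p).filter (fun n : ℕ => p ∈ S ∧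
        ∀ q ∈ S, x / 2 < (q * n : ℝ) → (q * n : ℝ) ≤ x → a (q * n) = 0)).card : ℝ) ≤
      ∑ m ∈ W, (((Nw m).filter (fun n : ℕ => m ∈ S ∧
        ∀ q ∈ S, x / 2 < (q * n : ℝ) → (q * n : ℝ) ≤ x → a (q * n) = 0)).card : ℝ) :=
    sum_le_sum_of_subset_of_nonneg hSW (fun _ _ _ => Nat.cast_nonneg _)
  have hsplit : ∑ p ∈ S, (x / (2 * p) - 1 - A.card * L) =
      ∑ p ∈ S, (x / (2 * p) - 1) - S.card * (A.card * L) := by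
    rw [sum_sub_distrib, sum_const, nsmul_eq_mul]
  have hchain := hsum.trans (hsub.trans hT)
  rw [hsplit] at hchain
  exact hchain

/-- **(II) against a thin support, primes on the `n`-side (reflected window).**  Let `S` be a
finite set of primes `p > M`, `p ≤ x`, with `p · (x/2)^θ ≤ x/2` and `x ≤ p · x^{θ+ν}` (so that
every cofactor `m`, `x/2 < mp ≤ x`, lies in the Type-II window), and let `A` contain the support
of `a` on `(x/2, x]`.  If `w = a − 1` satisfies (II), then
`∑_{p ∈ S} (x/(2p) − 1) − #S · (#A · log x / log M) ≤ x / (log x)^B`.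
[cite: FordMaynard2024PrimeSieves, §2.4] -/
theorem typeII_sparse_le' {a : ℕ → ℝ} {x θ ν B : ℝ} (hB : 0 ≤ B) (hx : 1 ≤ x) {M : ℝ}
    (hM : 1 < M) (S A : Finset ℕ)
    (hS : ∀ p ∈ S, p.Prime ∧ M < (p : ℝ) ∧ (p : ℝ) ≤ x ∧
      (p : ℝ) * (x / 2) ^ θ ≤ x / 2 ∧ x ≤ (p : ℝ) * x ^ (θ + ν))
    (hA : ∀ v : ℕ, x / 2 < (v : ℝ) → (v : ℝ) ≤ x → a v ≠ 0 → v ∈ A)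
    (h : TypeII (fun n : ℕ => a n - 1) x θ ν B) :
    ∑ p ∈ S, (x / (2 * p) - 1) - S.card * (A.card * (Real.log x / Real.log M))
      ≤ x / Real.log x ^ B := by
  set L := Real.log x / Real.log M with hL
  set W : Finset ℕ :=
    (Icc 1 ⌊x ^ (θ + ν)⌋₊).filter (fun m : ℕ => (x / 2) ^ θ < (m : ℝ)) with hW
  -- (II) tested against `ξ = 1_{good m}`, `κ = 1_S`
  have hT : ∑ m ∈ W, ((((Icc 1 ⌊x⌋₊).filter
      (fun n : ℕ => x / 2 < (m * n : ℝ) ∧ (m * n : ℝ) ≤ x)).filter (fun n : ℕ =>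
        (∀ q ∈ S, x / 2 < (q * m : ℝ) → (q * m : ℝ) ≤ x → a (q * m) = 0) ∧ n ∈ S)).card : ℝ)
      ≤ x / Real.log x ^ B := by
    refine typeII_zero_pairs_le hB
      (fun m : ℕ => ∀ q ∈ S, x / 2 < (q * m : ℝ) → (q * m : ℝ) ≤ x → a (q * m) = 0)
      (fun n : ℕ => n ∈ S) (fun m n hm hn h1 h2 => ?_) h
    have h1' : x / 2 < (n * m : ℝ) := by rw [mul_comm]; exact h1
    have h2' : (n * m : ℝ) ≤ x := by rw [mul_comm]; exact h2
    have := hm n hn h1' h2'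
    rwa [mul_comm] at this
  have hS' : ∀ p ∈ S, p.Prime ∧ M < (p : ℝ) := fun p hp => ⟨(hS p hp).1, (hS p hp).2.1⟩
  have hSI : S ⊆ Icc 1 ⌊x⌋₊ := fun p hp => by
    rw [mem_Icc]; exact ⟨(hS p hp).1.one_le, Nat.le_floor (hS p hp).2.2.1⟩
  have hswap := sum_card_filter_swap_le W S hSI
    (fun m : ℕ => ∀ q ∈ S, x / 2 < (q * m : ℝ) → (q * m : ℝ) ≤ x → a (q * m) = 0)
  -- the bad cofactors
  set E : Finset ℕ := W.filter (fun r : ℕ => ∃ p : ℕ, p ∈ S ∧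
      (x / 2 < (p * r : ℝ) ∧ (p * r : ℝ) ≤ x) ∧ a (p * r) ≠ 0) with hE
  have hEcard : (E.card : ℝ) ≤ A.card * L :=
    card_badCofactors_le hx hM S A E hS' hA (fun r hr => by
      have hr' := hr
      simp only [hE, Finset.mem_filter] at hr'
      exact hr'.2)
  have hstep : ∀ p ∈ S, x / (2 * p) - 1 - A.card * L ≤
      ((W.filter (fun m : ℕ => (x / 2 < (m * p : ℝ) ∧ (m * p : ℝ) ≤ x) ∧
        ∀ q ∈ S, x / 2 < (q * m : ℝ) → (q * m : ℝ) ≤ x → a (q * m) = 0)).card : ℝ) := by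
    intro p hp
    obtain ⟨hpr, hMp, hpx, hlow, hup⟩ := hS p hp
    have hp0 : 0 < p := hpr.pos
    have hp0' : (0 : ℝ) < p := by exact_mod_cast hp0
    -- the cofactor interval sits inside `W.filter (x/2 < mp ≤ x)`
    have hsub1 : Ioc ⌊x / (2 * p)⌋₊ ⌊x / p⌋₊ ⊆
        W.filter (fun m : ℕ => x / 2 < (m * p : ℝ) ∧ (m * p : ℝ) ≤ x) := by
      intro r hr
      obtain ⟨hr1, h1, h2⟩ := mem_Ioc_cofactor (by linarith) hp0 hr
      have h1' : x / 2 < (r : ℝ) * p := by rw [mul_comm]; exact h1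
      have h2' : (r : ℝ) * p ≤ x := by rw [mul_comm]; exact h2
      rw [Finset.mem_filter, hW, Finset.mem_filter, mem_Icc]
      refine ⟨⟨⟨hr1, Nat.le_floor ?_⟩, ?_⟩, h1', h2'⟩
      · -- `r ≤ x^(θ+ν)` since `x ≤ p x^(θ+ν)` and `r p ≤ x`
        by_contra hcon
        push Not at hcon
        have : x ^ (θ + ν) * p < r * p := mul_lt_mul_of_pos_right hcon hp0'
        linarith
      · -- `(x/2)^θ < r` since `p (x/2)^θ ≤ x/2 < r p`
        by_contra hcon
        push Not at hcon
        have : (r : ℝ) * p ≤ (x / 2) ^ θ * p := mul_le_mul_of_nonneg_right hcon hp0'.le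
        linarith
    have hN : x / (2 * p) - 1 ≤
        ((W.filter (fun m : ℕ => x / 2 < (m * p : ℝ) ∧ (m * p : ℝ) ≤ x)).card : ℝ) :=
      (sub_one_le_card_Ioc_cofactor (by linarith) hp0).trans
        (by exact_mod_cast card_le_card hsub1)
    have hsub2 : W.filter (fun m : ℕ => x / 2 < (m * p : ℝ) ∧ (m * p : ℝ) ≤ x) \ E ⊆
        W.filter (fun m : ℕ => (x / 2 < (m * p : ℝ) ∧ (m * p : ℝ) ≤ x) ∧
          ∀ q ∈ S, x / 2 < (q * m : ℝ) → (q * m : ℝ) ≤ x → a (q * m) = 0) := by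
      intro m hm
      rw [Finset.mem_sdiff, Finset.mem_filter] at hm
      rw [Finset.mem_filter]
      refine ⟨hm.1.1, hm.1.2, fun q hq h1 h2 => ?_⟩
      by_contra hne
      apply hm.2
      simp only [hE, Finset.mem_filter]
      exact ⟨hm.1.1, q, hq, ⟨h1, h2⟩, hne⟩
    have h1 : (W.filter (fun m : ℕ => x / 2 < (m * p : ℝ) ∧ (m * p : ℝ) ≤ x)).card ≤
        (W.filter (fun m : ℕ => (x / 2 < (m * p : ℝ) ∧ (m * p : ℝ) ≤ x) ∧
          ∀ q ∈ S, x / 2 < (q * m : ℝ) → (q * m : ℝ) ≤ x → a (q * m) = 0)).card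
          + E.card :=
      (Finset.card_le_card_sdiff_add_card).trans (Nat.add_le_add_right (card_le_card hsub2) _)
    have h1' : ((W.filter (fun m : ℕ => x / 2 < (m * p : ℝ) ∧ (m * p : ℝ) ≤ x)).card : ℝ) ≤
        (W.filter (fun m : ℕ => (x / 2 < (m * p : ℝ) ∧ (m * p : ℝ) ≤ x) ∧
          ∀ q ∈ S, x / 2 < (q * m : ℝ) → (q * m : ℝ) ≤ x → a (q * m) = 0)).card
          + E.card := by
      exact_mod_cast h1
    linarith
  have hsum := sum_le_sum hstep
  have hsplit : ∑ p ∈ S, (x / (2 * p) - 1 - A.card * L) =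
      ∑ p ∈ S, (x / (2 * p) - 1) - S.card * (A.card * L) := by
    rw [sum_sub_distrib, sum_const, nsmul_eq_mul]
  have hchain := hsum.trans (hswap.trans hT)
  rw [hsplit] at hchain
  exact hchain

end Summit.Parity.BatemanHorn.Theorems

end
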